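import Summits.AtomisticToContinuum.HydrodynamicLimit.Theorems.TwoClocksEntropyToHydro
import Summits.AtomisticToContinuum.HydrodynamicLimit.Theses.LambertianContactSwap
import Literature.MathematicalPhysics.KineticTheory.LambertianRedrawNondegenerate
import HarnessLib

/-!
# The entropy-inequality glue for the Lambertian gas:
# `RelEntropyVanishingLambda → LambertianEuler`
# (crux `LambertianContactSwap.LambertianEuler`, stmt-AtomisticToContinuum-11854, line `Sketch`,
# stub `stub_entropyToHydroLambda`)

The last step of the relative-entropy method (Yau 1991; Olla–Varadhan–Yau 1993 §3; Kipnis–Landim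
1999, Ch. 6) for the LAMBERTIAN hard-sphere gas `Λ`: if, for `t < T`, the law of `Λ_t` under the
local Gibbs law `⊗` the redraw noise has relative entropy `o(N)` with respect to a reference local
Gibbs law `localGibbsLaw σ a (u t) (θ t)` whose empirical fields concentrate exponentially around
the Euler fields, then the empirical fields of `Λ_t` converge in probability — the crux's
conclusion. The hypothesis `RelEntropyVanishingLambda` is the sub-problem's shared Yau node
`RelEntropyVanishing` (e.g. `TwoClocks.RelEntropyVanishing`) with the deterministic law at time `t`
`(Φ N).lawAt (localGibbsLaw …) t` replaced by `((localGibbsLaw …).prod lambertNoise).map Λ_t`.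
Proof: the tree's sequence lemma `tendsto_measure_of_klDiv_div_tendsto_zero`
(`TwoClocksEntropyToHydro`) and the transfer inequality
`(λ_N ⊗ γ^ℕ){p | Λ_t p ∈ A} ≤ ((λ_N ⊗ γ^ℕ) ∘ Λ_t⁻¹)(A)` (`Measure.le_map_apply`,
`measurable_lambertFlow_hsDiameter`; the crux's `σ₀` is capped at `1/2` for that measurability).
-/

noncomputable section

open MeasureTheory Filter Topology Set InformationTheory ProbabilityTheory
open scoped ENNReal

namespace Summit.AtomisticToContinuum.HydrodynamicLimit.Theorems.LambertianContactSwapLambertianEulerEntropyToHydro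

open Literature.MathematicalPhysics.KineticTheory Literature.Analysis.FluidPDE
open Summit.AtomisticToContinuum.HydrodynamicLimit.Theses.LambertianContactSwap

/-- **Convergence in probability of the fields of `Λ_t` from `o(N)` relative entropy.** For
`0 ≤ σ < 1/2`, Euler fields at time `t`, an initial local Gibbs law `λ_N` that is a probability
measure, reference laws `ψ_N = localGibbsLaw σ a (u t) (θ t)` that are finite with exponentially
concentrating empirical fields, and `KL((λ_N ⊗ γ^ℕ)∘Λ_t⁻¹ ‖ ψ_N)/(N+1) → 0`: the three
deviation probabilities of the fields of `Λ_t` under `λ_N ⊗ γ^ℕ` tend to `0`. [cite: Yau1991, §2] -/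
theorem tendsto_lambertFields_of_klDiv {σ : ℝ} (hσ : 0 ≤ σ) (hσ' : σ < 2⁻¹)
    {a₀ θ₀ a : T3 → ℝ} {u₀ : T3 → V3} {ρ θ : ℝ → T3 → ℝ} {u : ℝ → T3 → V3} {t : ℝ}
    (Φ : (N : ℕ) → HardSphereFlow (Torus.geometry (Fin 3)) (hsDiameter σ N) (N + 1))
    [hfin₀ : ∀ N, IsProbabilityMeasure (localGibbsLaw σ a₀ u₀ θ₀ N (Φ N))]
    [hfin : ∀ N, IsFiniteMeasure (localGibbsLaw σ a (u t) (θ t) N (Φ N))]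
    (hconc : ∀ χ : T3 → ℝ, Continuous χ → ∀ δ : ℝ, 0 < δ → ∃ C : ℝ, 0 < C ∧ ∀ N : ℕ,
      localGibbsLaw σ a (u t) (θ t) N (Φ N)
          {z | δ < |empiricalDensityField z χ - ∫ x, χ x * ρ t x|} ≤
        ENNReal.ofReal (C * Real.exp (-(C⁻¹ * (N + 1)))) ∧
      localGibbsLaw σ a (u t) (θ t) N (Φ N)
          {z | δ < ‖empiricalMomentumField z χ - ∫ x, (χ x * ρ t x) • u t x‖} ≤
        ENNReal.ofReal (C * Real.exp (-(C⁻¹ * (N + 1)))) ∧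
      localGibbsLaw σ a (u t) (θ t) N (Φ N)
          {z | δ < |empiricalEnergyField z χ -
            ∫ x, χ x * totalEnergyDensity (ρ t x) (u t x) (θ t x)|} ≤
        ENNReal.ofReal (C * Real.exp (-(C⁻¹ * (N + 1)))))
    (hkl : Tendsto (fun N : ℕ => klDiv
      (((localGibbsLaw σ a₀ u₀ θ₀ N (Φ N)).prod (lambertNoise (Fin 3))).map
        (fun p => lambertFlow (Torus.geometry (Fin 3)) (hsDiameter σ N) p.2 p.1 t))
      (localGibbsLaw σ a (u t) (θ t) N (Φ N)) / ((N : ℝ≥0∞) + 1)) atTop (𝓝 0))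
    (χ : T3 → ℝ) (hχ : Continuous χ) (δ : ℝ) (hδ : 0 < δ) :
    Tendsto (fun N : ℕ => ((localGibbsLaw σ a₀ u₀ θ₀ N (Φ N)).prod (lambertNoise (Fin 3)))
      {p | δ < |empiricalDensityField
        (lambertFlow (Torus.geometry (Fin 3)) (hsDiameter σ N) p.2 p.1 t) χ - ∫ x, χ x * ρ t x|})
      atTop (𝓝 0) ∧
    Tendsto (fun N : ℕ => ((localGibbsLaw σ a₀ u₀ θ₀ N (Φ N)).prod (lambertNoise (Fin 3)))
      {p | δ < ‖empiricalMomentumField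
        (lambertFlow (Torus.geometry (Fin 3)) (hsDiameter σ N) p.2 p.1 t) χ -
          ∫ x, (χ x * ρ t x) • u t x‖}) atTop (𝓝 0) ∧
    Tendsto (fun N : ℕ => ((localGibbsLaw σ a₀ u₀ θ₀ N (Φ N)).prod (lambertNoise (Fin 3)))
      {p | δ < |empiricalEnergyField
        (lambertFlow (Torus.geometry (Fin 3)) (hsDiameter σ N) p.2 p.1 t) χ -
          ∫ x, χ x * totalEnergyDensity (ρ t x) (u t x) (θ t x)|}) atTop (𝓝 0) := by
  obtain ⟨C, hC, hN⟩ := hconc χ hχ δ hδ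
  -- the laws of `Λ_t` and the transfer inequality along the (measurable) Lambertian flow
  have hmeas : ∀ N : ℕ, Measurable fun p : Config (N + 1) (Fin 3) T3 × (ℕ → V3) =>
      lambertFlow (Torus.geometry (Fin 3)) (hsDiameter σ N) p.2 p.1 t := fun N =>
    measurable_lambertFlow_hsDiameter hσ hσ' N t
  obtain ⟨μ, hμ⟩ : ∃ μ : ∀ N : ℕ, Measure (Config (N + 1) (Fin 3) T3), ∀ N, μ N =
      ((localGibbsLaw σ a₀ u₀ θ₀ N (Φ N)).prod (lambertNoise (Fin 3))).map
        (fun p => lambertFlow (Torus.geometry (Fin 3)) (hsDiameter σ N) p.2 p.1 t) :=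
    ⟨_, fun _ => rfl⟩
  haveI hμfin : ∀ N, IsFiniteMeasure (μ N) := fun N => by
    rw [hμ]
    infer_instance
  have htransfer : ∀ (N : ℕ) (A : Set (Config (N + 1) (Fin 3) T3)),
      ((localGibbsLaw σ a₀ u₀ θ₀ N (Φ N)).prod (lambertNoise (Fin 3)))
        {p | lambertFlow (Torus.geometry (Fin 3)) (hsDiameter σ N) p.2 p.1 t ∈ A} ≤ μ N A :=
    fun N A => by
      rw [hμ]
      exact Measure.le_map_apply (hmeas N).aemeasurable A
  have hkl' : Tendsto (fun N : ℕ => klDiv (μ N) (localGibbsLaw σ a (u t) (θ t) N (Φ N)) /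
      ((N : ℝ≥0∞) + 1)) atTop (𝓝 0) := by
    refine hkl.congr fun N => ?_
    rw [hμ]
  have key : ∀ A : ∀ N : ℕ, Set (Config (N + 1) (Fin 3) T3),
      (∀ N : ℕ, localGibbsLaw σ a (u t) (θ t) N (Φ N) (A N) ≤
        ENNReal.ofReal (C * Real.exp (-(C⁻¹ * ((N : ℝ) + 1))))) →
      Tendsto (fun N : ℕ => ((localGibbsLaw σ a₀ u₀ θ₀ N (Φ N)).prod (lambertNoise (Fin 3)))
        {p | lambertFlow (Torus.geometry (Fin 3)) (hsDiameter σ N) p.2 p.1 t ∈ A N}) atTop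
        (𝓝 0) := fun A hA => by
    have h := tendsto_measure_of_klDiv_div_tendsto_zero μ
      (fun N => localGibbsLaw σ a (u t) (θ t) N (Φ N)) A hC hA hkl'
    exact tendsto_of_tendsto_of_tendsto_of_le_of_le tendsto_const_nhds h
      (fun N => zero_le) (fun N => htransfer N (A N))
  refine ⟨?_, ?_, ?_⟩
  · exact key (fun N => {z | δ < |empiricalDensityField z χ - ∫ x, χ x * ρ t x|})
      (fun N => (hN N).1)
  · exact key (fun N => {z | δ < ‖empiricalMomentumField z χ - ∫ x, (χ x * ρ t x) • u t x‖})
      (fun N => (hN N).2.1)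
  · exact key (fun N => {z | δ < |empiricalEnergyField z χ -
        ∫ x, χ x * totalEnergyDensity (ρ t x) (u t x) (θ t x)|}) (fun N => (hN N).2.2)

/-- **`RelEntropyVanishingLambda → LambertianEuler`** — the registered stub
`stub_entropyToHydroLambda` of line `Sketch` (crux stmt-AtomisticToContinuum-11854), by name with its
registered signature: the entropy-inequality glue of the relative-entropy method for the
Lambertian gas (the crux's `σ₀` is the hypothesis' `σ₀` capped at `1/2`, where `Λ` is measurable;
at each `t < T`, `tendsto_lambertFields_of_klDiv`). [cite: Yau1991, §2]
[cite: KipnisLandim1999, Ch. 6 §1] -/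
theorem stub_entropyToHydroLambda :
    (∀ (a₀ θ₀ : Literature.MathematicalPhysics.KineticTheory.T3 → ℝ) (u₀ :
      Literature.MathematicalPhysics.KineticTheory.T3 →
      Literature.MathematicalPhysics.KineticTheory.V3), Continuous a₀ → Continuous θ₀ → Continuous
      u₀ → (∀ x, 0 < a₀ x) → (∀ x, 0 < θ₀ x) → ∃ σ₀ : ℝ, 0 < σ₀ ∧ ∀ σ : ℝ, 0 < σ → σ < σ₀ → ∀ (T :
      ℝ) (ρ θ : ℝ → Literature.MathematicalPhysics.KineticTheory.T3 → ℝ) (u : ℝ →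
      Literature.MathematicalPhysics.KineticTheory.T3 →
      Literature.MathematicalPhysics.KineticTheory.V3),
      Literature.MathematicalPhysics.KineticTheory.IsHardSphereEulerSolution σ T ρ u θ → ∀ Φ : (N :
      ℕ) → Literature.Analysis.FluidPDE.HardSphereFlow (Literature.Analysis.FluidPDE.Torus.geometry
      (Fin 3)) (Literature.MathematicalPhysics.KineticTheory.hsDiameter σ N) (N + 1), (∀ N,
      MeasureTheory.IsProbabilityMeasure
      (Literature.MathematicalPhysics.KineticTheory.localGibbsLaw σ a₀ u₀ θ₀ N (Φ N))) ∧
      (Literature.MathematicalPhysics.KineticTheory.TendstoHydroFieldsAt (fun N =>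
      Literature.MathematicalPhysics.KineticTheory.localGibbsLaw σ a₀ u₀ θ₀ N (Φ N)) Φ ρ u θ 0 → ∀
      t ∈ Set.Ico 0 T, ∃ a : Literature.MathematicalPhysics.KineticTheory.T3 → ℝ, (∀ N,
      MeasureTheory.IsProbabilityMeasure
      (Literature.MathematicalPhysics.KineticTheory.localGibbsLaw σ a (u t) (θ t) N (Φ N))) ∧ (∀ χ
      : Literature.MathematicalPhysics.KineticTheory.T3 → ℝ, Continuous χ → ∀ δ : ℝ, 0 < δ → ∃ C :
      ℝ, 0 < C ∧ ∀ N : ℕ, Literature.MathematicalPhysics.KineticTheory.localGibbsLaw σ a (u t) (θ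
      t) N (Φ N) {z | δ < |Literature.MathematicalPhysics.KineticTheory.empiricalDensityField z χ -
      ∫ x, χ x * ρ t x|} ≤ ENNReal.ofReal (C * Real.exp (-(C⁻¹ * (N + 1)))) ∧
      Literature.MathematicalPhysics.KineticTheory.localGibbsLaw σ a (u t) (θ t) N (Φ N) {z | δ <
      ‖Literature.MathematicalPhysics.KineticTheory.empiricalMomentumField z χ - ∫ x, (χ x * ρ t x)
      • u t x‖} ≤ ENNReal.ofReal (C * Real.exp (-(C⁻¹ * (N + 1)))) ∧
      Literature.MathematicalPhysics.KineticTheory.localGibbsLaw σ a (u t) (θ t) N (Φ N) {z | δ <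
      |Literature.MathematicalPhysics.KineticTheory.empiricalEnergyField z χ - ∫ x, χ x *
      Literature.MathematicalPhysics.KineticTheory.totalEnergyDensity (ρ t x) (u t x) (θ t x)|} ≤
      ENNReal.ofReal (C * Real.exp (-(C⁻¹ * (N + 1))))) ∧ Filter.Tendsto (fun N : ℕ =>
      InformationTheory.klDiv (((Literature.MathematicalPhysics.KineticTheory.localGibbsLaw σ a₀ u₀
      θ₀ N (Φ N)).prod (Literature.MathematicalPhysics.KineticTheory.lambertNoise (Fin 3))).map
      (fun p => Literature.MathematicalPhysics.KineticTheory.lambertFlow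
      (Literature.Analysis.FluidPDE.Torus.geometry (Fin 3))
      (Literature.MathematicalPhysics.KineticTheory.hsDiameter σ N) p.2 p.1 t))
      (Literature.MathematicalPhysics.KineticTheory.localGibbsLaw σ a (u t) (θ t) N (Φ N)) / ((N :
      ENNReal) + 1)) Filter.atTop (nhds 0))) →
    LambertianEuler := by
  intro hRE
  delta Summit.AtomisticToContinuum.HydrodynamicLimit.Theses.LambertianContactSwap.LambertianEuler
  intro Cfg G ε τ S ldir lpair lstep lstate linst lflow noise a₀ θ₀ u₀ ha hθ hu ha0 hθ0
  obtain ⟨σ₀, hσ₀, H⟩ := hRE a₀ θ₀ u₀ ha hθ hu ha0 hθ0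
  refine ⟨min σ₀ 2⁻¹, lt_min hσ₀ (by norm_num), fun σ hσ hσ' T ρ θ u hE Φ h0 t ht χ hχ δ hδ => ?_⟩
  have hσ₁ : σ < σ₀ := hσ'.trans_le (min_le_left _ _)
  have hσ₂ : σ < 2⁻¹ := hσ'.trans_le (min_le_right _ _)
  obtain ⟨hprob, hmain⟩ := H σ hσ hσ₁ T ρ θ u hE Φ
  obtain ⟨a, hψ, hconc, hkl⟩ := hmain h0 t ht
  exact tendsto_lambertFields_of_klDiv (a := a) hσ.le hσ₂ Φ hconc hkl χ hχ δ hδ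

end Summit.AtomisticToContinuum.HydrodynamicLimit.Theorems.LambertianContactSwapLambertianEulerEntropyToHydro

end
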